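import Mathlib
import HarnessLib
import Summits.HubbardSuperconductivity.HubbardSuperconductivity.Theorems.KLProgrammeKLRegimeAlphaWtClosedDatumRates
import Summits.HubbardSuperconductivity.HubbardSuperconductivity.Theorems.KLProgrammeKLRegimeAlphaWtScalars2
import Summits.HubbardSuperconductivity.HubbardSuperconductivity.Theorems.KLProgrammeKLRegimeAlphaWtSectionalScalars
import Summits.HubbardSuperconductivity.HubbardSuperconductivity.Theorems.KLProgrammeKLRegimeSectorSlicePairWtFatSectional

/-!
# Route `KLProgramme` — engine / VL support, route (L2), FAT layer, WEIGHTED, SECTIONAL: **the uniform SECTIONAL per-pair bound in CLOSED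
# FORM for a SHIFTED slice** `(Λₛ, Λ′]`, `Λ_{m+1} = r·Λₛ`, `r ≥ 1` (the door's `r = 4^j`) — ε-FREE, Λ-FREE, L-FREE (one power `r^{3/2}`)

Cell `gate-hubbard-kl`, seat p3 (g12), for the «sectional row `eW′`» in the SECTOR currency (k3c4-p1 M3b-j (ii), `…TwoVolumeSrcSectorScaleSuccMinS`
hypothesis `hsecW'`, field `ScaleCovSecData.sec` of `…TwoVolumeSpineDataDefs`).  The shifted-slice twin of `slicePairWt_bgmFat_sectional_closed`
(p3 g11), assembled as `slicePairWt_bgmFat_closed_datum` is: the four SPATIAL rate inequalities are the outputs `hrspace`, `hr₃`, `hr₃′` of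
`sliceRatesWt_closed_datum` (the time one is discarded), the core is `slicePairWt_bgmFat_sectional_le` at `Λ := Λₛ`, the packaging is `wBracketWt_le`
(`s₀ = 1`, `x₀ = 1`, `Mβ := Λₛ`), `fatCellCount_le` (cell geometry at the sector scale `Λ_{m+1} = rΛₛ`) and `alphaProductWtSectional_le_mul`.
Frame third derivative only via the datum `K₃Λₛ² ≤ k₃`; `q_v` reads `e₀/r`.

* `alphaProductWtSectional_le_mul` — the final product with the time-section count charged `≤ 16Λₛβ/π · r`;
* **`slicePairWt_bgmFat_sectional_closed_datum`** — for every pair `(ω, ω′)` and EVERY time difference `z₁`,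
  `Σ_{z₂} (1 + s₁|z̃₂|₁)‖S[(βL²)⁻²F̃_ωF̃_{ω′}Ψ̂_{(Λₛ,Λ′]}](z₁, z₂)‖ ≤ (64/π)·r·√(24·C_W¹·C_N¹)`, `s₁ = 2Λₛ/(πX₁)`,
  `C_W¹ = 64(1 + 5√2 + 5√2X₃)²·(4096·(4(2√2x₂+2)(2√2x₃+1)) + 160x₁(x₁+1)²/δ_L)`, `C_N¹ = 16c₁c_ρ/(π(2ρ_min − 4A)) · r` — no `M/β`, `1/Λ`, `L`.

Everything is proved; no definitions. [cite: BenfattoGiulianiMastropietro2006, §2.8 (2.81), §3 (3.3)]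
-/
noncomputable section

namespace Summit.HubbardSuperconductivity.HubbardSuperconductivity.Theorems.TorusFourierL2

set_option linter.dupNamespace false -- summit = problem name (single-conjunct summit), D-0017

open Set Finset Literature.MathematicalPhysics.QuantumLattice Literature.MathematicalPhysics.QuantumLattice.BandSectorCounting
open Literature.MathematicalPhysics.QuantumLattice.FermiRG Literature.Probability.LatticeModels Literature.Analysis.SpecialFunctions
open Summit.HubbardSuperconductivity.HubbardSuperconductivity.Theorems.DispersionFlow
open Summit.HubbardSuperconductivity.HubbardSuperconductivity.Theorems.KLRegimeSplit
open Summit.HubbardSuperconductivity.HubbardSuperconductivity.Theorems.KLProgrammeLegKernels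
open Summit.HubbardSuperconductivity.HubbardSuperconductivity.Theorems.PerturbedFermiCurve
open scoped Real Nat

/-- **The final sectional product with a ratio**: if `W ≤ C_W·N_r/Λ`, `N̄_cell ≤ C_N·L²Λ/N_r` and `N_t ≤ (16Λβ/π)·r` (`r ≥ 0`), then
`N_t·(√W·√(24·L²·N̄_cell)·((βL²)⁻²·4βL²/Λ)) ≤ (64/π)·r·√(24·C_W·C_N)`. [folklore] -/
theorem alphaProductWtSectional_le_mul {W Nc CW CN Nt β L Λ Nr r : ℝ} (hW0 : 0 ≤ W) (hNc0 : 0 ≤ Nc) (hCW : 0 ≤ CW) (hCN : 0 ≤ CN)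
    (hβ : 0 < β) (hL : 0 < L) (hΛ : 0 < Λ) (hNr : 0 < Nr) (hr : 0 ≤ r) (hW : W ≤ CW * Nr / Λ) (hNc : Nc ≤ CN * (L ^ 2 * Λ / Nr))
    (hNt : Nt ≤ 16 * Λ * β / Real.pi * r) :
    Nt * (Real.sqrt W * Real.sqrt (24 * L ^ 2 * Nc) * ((1 / (β * L ^ 2)) ^ 2 * (4 * (β * L ^ 2) / Λ))) ≤
      64 / Real.pi * r * Real.sqrt (24 * CW * CN) := by
  have h := alphaProductWtSectional_le hW0 hNc0 hCW hCN hβ hL hΛ hNr hW hNc le_rfl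
  have hX : 0 ≤ Real.sqrt W * Real.sqrt (24 * L ^ 2 * Nc) * ((1 / (β * L ^ 2)) ^ 2 * (4 * (β * L ^ 2) / Λ)) := by positivity
  calc Nt * (Real.sqrt W * Real.sqrt (24 * L ^ 2 * Nc) * ((1 / (β * L ^ 2)) ^ 2 * (4 * (β * L ^ 2) / Λ)))
      ≤ (16 * Λ * β / Real.pi * r) * (Real.sqrt W * Real.sqrt (24 * L ^ 2 * Nc) * ((1 / (β * L ^ 2)) ^ 2 * (4 * (β * L ^ 2) / Λ))) :=
        mul_le_mul_of_nonneg_right hNt hX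
    _ = r * ((16 * Λ * β / Real.pi) * (Real.sqrt W * Real.sqrt (24 * L ^ 2 * Nc) * ((1 / (β * L ^ 2)) ^ 2 * (4 * (β * L ^ 2) / Λ)))) := by ring
    _ ≤ r * (64 / Real.pi * Real.sqrt (24 * CW * CN)) := mul_le_mul_of_nonneg_left h hr
    _ = 64 / Real.pi * r * Real.sqrt (24 * CW * CN) := by ring

section Closed

open Classical

variable {L M : ℕ} [NeZero L] [NeZero M] {a b : ℝ} (B : BandBounds a b) {K : TrigPolyC4v} {A : ℝ}
  (hA : ∀ p : Momentum, ∀ j ≤ 2, ‖iteratedFDeriv ℝ j (frameShift K) p‖ ≤ A) (hADt : 2 * A < B.Dtmin)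
  {μ e₀ z β : ℝ} (he : 0 < e₀) (hz : 0 < z) (hz1 : z ≤ 1) (hgap : e₀ + A + z ^ 2 < -μ) (h3 : e₀ + A - μ ≤ 3)
  (hlo : a ≤ μ - A - e₀) (hhi : μ + A + e₀ ≤ b) (hβ : 0 < β) (hρA : 4 * A < 2 * B.rhomin)
  (m : ℕ) (hMm : klScale e₀ m * β < π * (2 * M - 5))
  {d : ℝ} (hd : 0 ≤ d) (hd1 : ∀ u, |deriv (bgmCutoffSq e₀) u| ≤ d) (hd2 : ∀ u, |iteratedDeriv 2 (bgmCutoffSq e₀) u| ≤ d)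
  (hd3 : ∀ u, |iteratedDeriv 3 (bgmCutoffSq e₀) u| ≤ d)
  {A₃ a₃ : ℝ} (hA3 : ∀ p : Momentum, ‖iteratedFDeriv ℝ 3 (frameShift K) p‖ ≤ A₃) (ha3 : A₃ * klScale e₀ m ^ 2 ≤ a₃)
  {Ba : ℝ} (hB0 : 0 ≤ Ba)
  (hB : ∀ (i : ℕ), i ≤ 2 → ∀ (n : ℕ) (ω : ℤ) (θ₀ : ℝ) (q w : Fin 2 → ℝ) (t : ℝ) {r₀ : ℝ}, 0 < r₀ →
    r₀ ≤ ‖momToComplex (q + t • w)‖ → |sectorRelAngle θ₀ (q + t • w)| < π →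
    ‖iteratedDeriv i (fun t : ℝ => sectorWeightCirc n ω (polarAngle (q + t • w))) t‖ ≤
      (2 : ℕ)! * Ba * ((1 + (sectorWidth n)⁻¹ * (2 : ℕ)!) * ‖momToComplex w‖ / r₀) ^ i)
  {Ba3 : ℝ} (hB30 : 0 ≤ Ba3)
  (hB3 : ∀ (i : ℕ), i ≤ 3 → ∀ (n : ℕ) (ω : ℤ) (θ₀ : ℝ) (q w : Fin 2 → ℝ) (t : ℝ) {r₀ : ℝ}, 0 < r₀ →
    r₀ ≤ ‖momToComplex (q + t • w)‖ → |sectorRelAngle θ₀ (q + t • w)| < π →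
    ‖iteratedDeriv i (fun t : ℝ => sectorWeightCirc n ω (polarAngle (q + t • w))) t‖ ≤
      (3 : ℕ)! * Ba3 * ((1 + (sectorWidth n)⁻¹ * (3 : ℕ)!) * ‖momToComplex w‖ / r₀) ^ i)
  {Λs Λ' r : ℝ} (hΛs : 0 < Λs) (hr : 1 ≤ r) (hΛsr : klScale e₀ (m + 1) = r * Λs) (hΛΛ' : Λs ≤ Λ')
  {K₁ K₂ K₃ : ℝ} (hK₁pos : 0 < K₁) (hK₁ : ∀ p, ‖fderiv ℝ (frameLevel μ K) p‖ ≤ K₁) (hK₂ : ∀ p, ‖iteratedFDeriv ℝ 2 (frameLevel μ K) p‖ ≤ K₂)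
  (hK₃ : ∀ p, ‖iteratedFDeriv ℝ 3 (frameLevel μ K) p‖ ≤ K₃) {k₃ : ℝ} (hk₃ : K₃ * Λs ^ 2 ≤ k₃)
  {B₁ B₂ B₃ : ℝ} (hB₁ : ∀ x, |deriv salmhoferCutoff x| ≤ B₁) (hB₂ : ∀ x, |deriv (deriv salmhoferCutoff) x| ≤ B₂)
  (hB₃ : ∀ x, |deriv (deriv (deriv salmhoferCutoff)) x| ≤ B₃)
  -- regime
  (he₁ : e₀ ≤ 1) (hπβ : π ≤ klScale e₀ m * β)
  (hLz : 3 * |2 * π / L| * ((2 : ℝ) ^ (m + 1) + 1 / 2) ≤ z) (hLN : 2 * π * (2 : ℝ) ^ (m + 1) * ((2 : ℝ) ^ (m + 1) + 1 / 2) ≤ L)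
  (hL1 : (2 * B.rhomin - 4 * A) * π ≤ 2 * Real.sqrt 2 * L * klScale e₀ (m + 1))
  {R₀ : ℕ} (hR₀ : 2 * (2 * (2 : ℝ) ^ (m + 1) + 1) * (R₀ : ℝ) < L) (hR₀' : (L : ℝ) / (10 * (2 : ℝ) ^ (m + 1)) ≤ R₀)
  {δL : ℝ} (hδL : 0 < δL) (hΛL : δL ≤ Λs ^ 2 * L)
  -- the closed-form constants (instantiate with `rfl`)
  {cρ G₁ G₂ G₃ κ₃F Kp bτ ae1 ae2 av1 av2 qv q3e q3v X₁ X₃ x₁ x₂ x₃ c₁ CW CN : ℝ}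
  (hcρ : cρ = (2 * e₀ / π + B.smax * B.Dtmin * (3 / 4)) / (B.Dtmin - 2 * A) + π * Real.sqrt 2 * (1 + (4 + 2 * A) / (B.Dtmin - 2 * A)))
  (hG₁ : G₁ = d * e₀ ^ 2 * 1 + 1 * (d * e₀ ^ 2)) (hG₂ : G₂ = d * e₀ ^ 4 * 1 + 2 * (d * e₀ ^ 2) * (d * e₀ ^ 2) + 1 * (d * e₀ ^ 4))
  (hG₃ : G₃ = d * e₀ ^ 6 * 1 + 3 * (d * e₀ ^ 4) * (d * e₀ ^ 2) + 3 * (d * e₀ ^ 2) * (d * e₀ ^ 4) + 1 * (d * e₀ ^ 6))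
  (hκ₃F : κ₃F = (8 * G₃ + 12 * G₂) * (4 + 2 * A) ^ 3 + (12 * G₂ + 6 * G₁) * (4 + 2 * A) * (4 + 4 * A) * e₀ +
      2 * G₁ * (4 * e₀ ^ 2 + 8 * a₃) +
      216 * 9 * Ba3 * ((4 * G₂ + 2 * G₁) * (4 + 2 * A) ^ 2 * (2 * e₀) + 2 * G₁ * (4 + 4 * A) * e₀ * (2 * e₀)) +
      216 * 9 * G₁ * (4 + 2 * A) * (12 * Ba3 + 72 * Ba3 ^ 2) * (2 * e₀) ^ 2 + 216 * 9 * (12 * Ba3 + 216 * Ba3 ^ 2) * (2 * e₀) ^ 3)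
  (hKp : Kp = 4 + 4 * A) (hbτ : bτ = 4 + 2 * A + 2 * K₂ * (cρ * π))
  (hae1 : ae1 = G₁ * (4 + 2 * A + Kp * (cρ * π + 2)) / 2 + 72 * Ba * e₀)
  (hae2 : ae2 = (4 * G₂ + 2 * G₁) * (4 + 2 * A + Kp * (cρ * π + 2)) ^ 2 / 16 + G₁ * Kp * e₀ / 2 +
    144 * G₁ * (4 + 2 * A + Kp * (cρ * π + 2)) * Ba * e₀ + 36 * (4 * Ba + 8 * Ba ^ 2) * e₀ ^ 2)
  (hav1 : av1 = G₁ * (4 + 2 * A + Kp * (cρ * π + 2)) / (2 * e₀) + 288 * Ba)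
  (hav2 : av2 = (4 * G₂ + 2 * G₁) * (4 + 2 * A + Kp * (cρ * π + 2)) ^ 2 / (16 * e₀ ^ 2) + G₁ * Kp / (2 * e₀) +
    144 * G₁ * (4 + 2 * A + Kp * (cρ * π + 2)) * Ba / e₀ + 144 * (4 * Ba + 8 * Ba ^ 2))
  (hqv : qv = (32 * B₂ + 144 * B₁ + 128) * (bτ + 8 * K₂) ^ 2 / (4 * (e₀ / r) ^ 2) + (16 * B₁ + 16) * K₂ / (2 * (e₀ / r)) +
    av1 * (16 * B₁ + 16) * (bτ + 6 * K₂) / (2 * (e₀ / r)) + av2)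
  (hq3e : q3e = (64 * B₃ + 480 * B₂ + 1728 * B₁ + 1536) * (Real.sqrt 2 * K₁ + 12 * K₂) ^ 3 / 4 +
    3 / 2 * (32 * B₂ + 144 * B₁ + 128) * K₂ * (Real.sqrt 2 * K₁ + 12 * K₂) * e₀ + Real.sqrt 2 / 2 * (16 * B₁ + 16) * k₃ +
    3 * ae1 * ((32 * B₂ + 144 * B₁ + 128) * (Real.sqrt 2 * K₁ + 10 * K₂) ^ 2 / 4 + (16 * B₁ + 16) * K₂ * e₀ / 2) +
    3 / 4 * ae2 * (16 * B₁ + 16) * (Real.sqrt 2 * K₁ + 8 * K₂) + κ₃F / 64)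
  (hq3v : q3v = (64 * B₃ + 480 * B₂ + 1728 * B₁ + 1536) * (bτ + 12 * K₂) ^ 3 / 4 +
    3 / 2 * (32 * B₂ + 144 * B₁ + 128) * K₂ * (bτ + 12 * K₂) * e₀ + Real.sqrt 2 / 2 * (16 * B₁ + 16) * k₃ +
    3 * (e₀ * av1 / 2) * ((32 * B₂ + 144 * B₁ + 128) * (bτ + 10 * K₂) ^ 2 / 4 + (16 * B₁ + 16) * K₂ * e₀ / 2) +
    3 / 4 * (e₀ ^ 2 * av2) * (16 * B₁ + 16) * (bτ + 8 * K₂) + κ₃F / 64)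
  (hX₁ : X₁ = max 1 q3e) (hX₃ : X₃ = max 1 q3v)
  (hx₁ : x₁ = π * X₁ / 2) (hx₂ : x₂ = 5 * π / 4 * X₁) (hx₃ : x₃ = 5 * π / 4 * Real.sqrt qv)
  (hc₁ : c₁ = 4 + Kp * cρ ^ 2 * π ^ 2 / e₀)
  (hCW : CW = 64 * (1 + 5 * Real.sqrt 2 + 5 * Real.sqrt 2 * X₃) ^ 2 *
    (4096 * 1 * (4 * ((2 * Real.sqrt 2 * x₂ + 2) * (2 * Real.sqrt 2 * x₃ + 1)) + 160 * x₁ * (x₁ + 1) ^ 2 / δL)))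
  (hCN : CN = 16 * c₁ * cρ / (π * (2 * B.rhomin - 4 * A)) * r)

include B hA hADt he hz hz1 hgap h3 hlo hhi hβ hρA hMm hd hd1 hd2 hd3 hA3 ha3 hB0 hB hB30 hB3 hΛs hr hΛsr hΛΛ' hK₁pos hK₁ hK₂ hK₃ hk₃ hB₁ hB₂ hB₃
  he₁ hπβ hLz hLN hL1 hR₀ hR₀' hδL hΛL hcρ hG₁ hG₂ hG₃ hκ₃F hKp hbτ hae1 hae2 hav1 hav2 hqv hq3e hq3v hX₁ hX₃ hx₁ hx₂ hx₃ hc₁ hCW hCN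

set_option maxHeartbeats 3000000 in
/-- **The uniform SECTIONAL per-pair bound in closed form, SHIFTED slice** (`≤ (64/π)·r·√(24·C_W¹·C_N¹)`, weight `1 + s₁|z̃₂|₁` with the
canonical spatial rate `s₁ = 2Λₛ/(πX₁)`, uniformly in the time difference; frame third derivative via the datum `K₃Λₛ² ≤ k₃`; see the module
docstring). [cite: BenfattoGiulianiMastropietro2006, §2.8 (2.81), §3 (3.3)] -/
theorem slicePairWt_bgmFat_sectional_closed_datum (ω ω' : Fin (sectorCount (m + 1))) :
    ∀ z₁ : TorusSite 1 (2 * M), ∑ z₂ : TorusSite 2 L,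
        (1 + 2 * Λs / (π * X₁) * |(((z₂ 0).valMinAbs : ℤ) : ℝ)| +
            2 * Λs / (π * X₁) * |(((z₂ 1).valMinAbs : ℤ) : ℝ)|) *
        ‖∑ q : TorusSite 1 (2 * M) × TorusSite 2 L, (torusChar q.1 z₁ * torusChar q.2 z₂) •
          ((((1 / (β * (L : ℝ) ^ 2) : ℝ) : ℂ) ^ 2 *
            (bgmFatMultiplier L M e₀ β (nambuXiCT L μ K) (m + 1) ω (⟨(q.1 0).val, ZMod.val_lt (q.1 0)⟩, q.2) *
              bgmFatMultiplier L M e₀ β (nambuXiCT L μ K) (m + 1) ω' (⟨(q.1 0).val, ZMod.val_lt (q.1 0)⟩, q.2) *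
              sliceSymbolFnXi (β * (L : ℝ) ^ 2) 0 Λs Λ' (matsubaraFreq β M ⟨(q.1 0).val, ZMod.val_lt (q.1 0)⟩)
                (nambuXiCT L μ K q.2))))‖ ≤
      64 / π * r * Real.sqrt (24 * CW * CN) := by
  -- the scales and the tangent resolution
  have hπ := Real.pi_pos
  have hL : (0 : ℝ) < L := Nat.cast_pos.2 (Nat.pos_of_ne_zero (NeZero.ne L))
  set Λ : ℝ := klScale e₀ (m + 1) with hΛdef
  set Nr : ℝ := (2 : ℝ) ^ (m + 1) with hNrdef
  have hΛ : 0 < Λ := by rw [hΛdef, klScale]; positivity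
  have hNr2 : 2 ≤ Nr := by
    rw [hNrdef]
    calc (2 : ℝ) = 2 ^ 1 := by norm_num
      _ ≤ 2 ^ (m + 1) := pow_le_pow_right₀ (by norm_num) (by omega)
  have hNr0 : 0 < Nr := by linarith only [hNr2]
  have hNr1 : 1 ≤ Nr := by linarith only [hNr2]
  have hNrsq : Nr ^ 2 = (4 : ℝ) ^ (m + 1) := by
    rw [hNrdef, ← pow_mul, show (4 : ℝ) = 2 ^ 2 by norm_num, ← pow_mul]; ring_nf
  have hNrΛ : Nr ^ 2 * Λ = e₀ := by rw [hNrsq, hΛdef, klScale]; field_simp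
  have hΛm : klScale e₀ m = 4 * Λ := by rw [hΛdef, klScale, klScale, pow_succ]; field_simp
  have hΛm0 : 0 < klScale e₀ m := by rw [hΛm]; positivity
  have hΛe : Λ ≤ e₀ := klScale_le_e0 he.le (m + 1)
  have hr0 : 0 < r := lt_of_lt_of_le one_pos hr
  have hΛsr' : Λ = r * Λs := by rw [hΛdef]; exact hΛsr
  have hΛsΛ : Λs ≤ Λ := by rw [hΛsr']; exact le_mul_of_one_le_left hΛs.le hr
  have hΛse : Λs ≤ e₀ := hΛsΛ.trans hΛe
  have hΛ1 : Λs ≤ 1 := hΛse.trans he₁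
  have hNrΛ' : Nr * Λ ≤ e₀ / 2 := by
    have : Nr * Λ = e₀ / Nr := by rw [eq_div_iff hNr0.ne', ← hNrΛ]; ring
    rw [this]; exact div_le_div_of_nonneg_left he.le (by norm_num) hNr2
  have hw : sectorWidth (m + 1) = π / Nr := by rw [sectorWidth, hNrdef]
  have hwsi : 1 + 2 * (sectorWidth (m + 1))⁻¹ ≤ 2 * Nr := by
    rw [hw, inv_div]
    have : 2 * (Nr / π) ≤ Nr := by rw [mul_div_assoc']; rw [div_le_iff₀ hπ]; nlinarith only [Real.pi_gt_three, hNr0]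
    linarith only [this, hNr2]
  have hwsi0 : 0 ≤ (sectorWidth (m + 1))⁻¹ := by rw [hw]; positivity
  -- constants: nonnegativity
  have hA0 : 0 ≤ A := (norm_nonneg _).trans (hA 0 0 (by norm_num))
  have hK10 : 0 ≤ K₁ := hK₁pos.le
  have hK20 : 0 ≤ K₂ := le_trans (norm_nonneg _) (hK₂ 0)
  have hK30 : 0 ≤ K₃ := le_trans (norm_nonneg _) (hK₃ 0)
  have hk30 : 0 ≤ k₃ := le_trans (by positivity) hk₃
  have hB10 : 0 ≤ B₁ := (abs_nonneg _).trans (hB₁ 0)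
  have hB20 : 0 ≤ B₂ := (abs_nonneg _).trans (hB₂ 0)
  have hB30' : 0 ≤ B₃ := (abs_nonneg _).trans (hB₃ 0)
  have hDt0 : 0 < B.Dtmin - 2 * A := by linarith only [hADt]
  have hγ : 0 < 2 * B.rhomin - 4 * A := by linarith only [hρA]
  have hcρ0 : 0 ≤ cρ := by rw [hcρ]; have := B.smax_pos; have := B.Dtmin_pos; positivity
  have hG₁0 : 0 ≤ G₁ := by rw [hG₁]; positivity
  have hG₂0 : 0 ≤ G₂ := by rw [hG₂]; positivity
  have hG₃0 : 0 ≤ G₃ := by rw [hG₃]; positivity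
  have hA30 : 0 ≤ A₃ := le_trans (norm_nonneg _) (hA3 0)
  have ha30 : 0 ≤ a₃ := le_trans (by positivity) ha3
  have hκ₃F0 : 0 ≤ κ₃F := by rw [hκ₃F]; positivity
  have hKp0 : 0 ≤ Kp := by rw [hKp]; positivity
  have hbτ0 : 0 ≤ bτ := by rw [hbτ]; positivity
  have hae10 : 0 ≤ ae1 := by rw [hae1]; positivity
  have hae20 : 0 ≤ ae2 := by rw [hae2]; positivity
  have hav10 : 0 ≤ av1 := by rw [hav1]; positivity
  have hav20 : 0 ≤ av2 := by rw [hav2]; positivity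
  have hqv0 : 0 < qv := by
    rw [hqv]
    have : 0 < (32 * B₂ + 144 * B₁ + 128) * (bτ + 8 * K₂) ^ 2 / (4 * (e₀ / r) ^ 2) := by
      have : 0 < bτ + 8 * K₂ := by rw [hbτ]; positivity
      positivity
    positivity
  obtain ⟨hX₁c, hX₁0⟩ := le_max_one_pow_three q3e
  obtain ⟨hX₃c, hX₃0⟩ := le_max_one_pow_three q3v
  rw [← hX₁] at hX₁c hX₁0
  rw [← hX₃] at hX₃c hX₃0
  have hX₁1 : 1 ≤ X₁ := by rw [hX₁]; exact le_max_left _ _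
  have hx₁0 : 0 < x₁ := by rw [hx₁]; positivity
  have hx₂0 : 0 ≤ x₂ := by rw [hx₂]; positivity
  have hx₃0 : 0 ≤ x₃ := by rw [hx₃]; positivity
  have hc₁0 : 0 ≤ c₁ := by rw [hc₁]; positivity
  have hCW0 : 0 ≤ CW := by rw [hCW]; positivity
  have hCN0 : 0 ≤ CN := by rw [hCN]; positivity
  -- the steps
  set ℓ₁ : ℝ := 2 * π / L with hℓ₁
  set ℓ : ℝ := 2 * π / L * (Nr + 1 / 2) with hℓ
  have hℓ₁0 : 0 < ℓ₁ := by positivity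
  have hℓ0 : 0 < ℓ := by positivity
  have hℓNr : ℓ * Nr ≤ 1 := by
    rw [hℓ, div_mul_eq_mul_div, div_mul_eq_mul_div, div_le_one hL]; linarith only [hLN]
  have hℓle1 : ℓ ≤ 1 := le_trans (le_mul_of_one_le_right hℓ0.le hNr1) hℓNr
  have hℓ₁ℓNr : ℓ₁ ≤ ℓ / Nr := by
    rw [hℓ, hℓ₁, le_div_iff₀ hNr0]
    exact mul_le_mul_of_nonneg_left (by linarith only []) (by positivity)
  have hℓ₁ℓ : ℓ₁ ≤ ℓ := hℓ₁ℓNr.trans (div_le_self hℓ0.le hNr1)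
  have hℓ₁le1 : ℓ₁ ≤ 1 := hℓ₁ℓ.trans hℓle1
  have habs : |2 * π / (L : ℝ)| = ℓ₁ := abs_of_pos hℓ₁0
  -- the cell radius
  set ρf : ℝ := (klScale e₀ m + B.smax * B.Dtmin * (3 * sectorWidth (m + 1) / 4)) / (B.Dtmin - 2 * A) +
    π * Real.sqrt 2 * (1 + (4 + 2 * A) / (B.Dtmin - 2 * A)) * sectorWidth (m + 1) with hρf
  have hρf0 : 0 ≤ ρf := by rw [hρf]; have := B.smax_pos; have := B.Dtmin_pos; have := sectorWidth_pos (m + 1); positivity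
  have hρfb : ρf ≤ cρ * π / Nr := by
    rw [hρf, hcρ, hw, hΛm]
    have h4Λ : 4 * Λ ≤ 2 * e₀ / π * (π / Nr) := by
      have e : 2 * e₀ / π * (π / Nr) = 2 * e₀ / Nr := by field_simp
      rw [e, le_div_iff₀ hNr0]
      have := mul_le_mul_of_nonneg_left hNrΛ' (by norm_num : (0:ℝ) ≤ 4)
      linarith only [this]
    have hsm := B.smax_pos; have hdt := B.Dtmin_pos
    have e2 : ((2 * e₀ / π + B.smax * B.Dtmin * (3 / 4)) / (B.Dtmin - 2 * A) + π * Real.sqrt 2 * (1 + (4 + 2 * A) / (B.Dtmin - 2 * A))) * π / Nr =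
        (2 * e₀ / π * (π / Nr) + B.smax * B.Dtmin * (3 * (π / Nr) / 4)) / (B.Dtmin - 2 * A) +
          π * Real.sqrt 2 * (1 + (4 + 2 * A) / (B.Dtmin - 2 * A)) * (π / Nr) := by
      field_simp
    rw [e2]
    gcongr
  -- shell thickness for the support count
  have hsh : klScale e₀ m + Kp * ρf ^ 2 ≤ Λ * c₁ := by
    rw [hΛm, hc₁]
    have h1 : ρf ^ 2 ≤ (cρ * π / Nr) ^ 2 := pow_le_pow_left₀ hρf0 hρfb 2
    have h2 : Kp * ρf ^ 2 ≤ Kp * (cρ * π / Nr) ^ 2 := mul_le_mul_of_nonneg_left h1 hKp0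
    have e : Λ * (4 + Kp * cρ ^ 2 * π ^ 2 / e₀) = 4 * Λ + Kp * (cρ * π / Nr) ^ 2 := by
      rw [← hNrΛ]; field_simp
    rw [e]; linarith only [h2]
  -- the (auxiliary) time-rate constants of `sliceRatesWt_closed_datum` (its time inequality is discarded)
  obtain ⟨Dt3, hDt3⟩ : ∃ Dt3 : ℝ, Dt3 = 2 * (64 * B₃ + 480 * B₂ + 1728 * B₁ + 1536) + 3 * G₁ * (32 * B₂ + 144 * B₁ + 128) +
      3 / 8 * (4 * G₂ + 2 * G₁) * (16 * B₁ + 16) + (8 * G₃ + 12 * G₂) / 8 := ⟨_, rfl⟩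
  obtain ⟨X₀, hX₀⟩ : ∃ X₀ : ℝ, X₀ = max 1 Dt3 := ⟨_, rfl⟩
  -- the rates
  set s₀ : ℝ := 2 * Λs * β / ((M : ℝ) * π * X₀) with hs₀
  set s₁ : ℝ := 2 * Λs / (π * X₁) with hs₁
  set s₂ : ℝ := 2 * Λs / (π * (Nr + 1 / 2) * X₁) with hs₂
  set s₃ : ℝ := 2 / (π * (Nr + 1 / 2) * Nr * Real.sqrt qv) with hs₃
  set s₃' : ℝ := 2 * Λs / (π * (Nr + 1 / 2) * X₃) with hs₃'
  have hsv : 0 < Real.sqrt qv := Real.sqrt_pos.2 hqv0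
  have hs₁0 : 0 < s₁ := by positivity
  have hs₂0 : 0 < s₂ := by positivity
  have hs₃0 : 0 < s₃ := by positivity
  have hs₃'0 : 0 < s₃' := by positivity
  have hsvsq : Real.sqrt qv ^ 2 = qv := Real.sq_sqrt hqv0.le
  obtain ⟨-, hrspace, hr₃, hr₃'⟩ := sliceRatesWt_closed_datum B hA hADt he hβ hρA m hd hA3 ha3 hB0 hB30 hΛs hr hΛsr hK₁pos hK₂ hK₃ hk₃
    hB₁ hB₂ hB₃ hLN hcρ hG₁ hG₂ hG₃ hκ₃F hKp hbτ hae1 hae2 hav1 hav2 hqv hDt3 hq3e hq3v hX₀ hX₁ hX₃ hNrdef hℓ hρf hs₀ hs₃ hs₃'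
  have hr₁ := hrspace ℓ₁ s₁ hℓ₁0 hℓ₁le1 (by rw [hs₁, hℓ₁]; field_simp)
  have hr₂ := hrspace ℓ s₂ hℓ0 hℓle1 (by rw [hs₂, hℓ]; field_simp)
  -- the integer frame vector and the per-pair theorem
  have hlo' : a ≤ μ - A := (by linarith only [hlo, he]); have hhi' : μ + A ≤ b := by linarith only [hhi, he]
  set pF : Fin 2 → ℝ := klFermiPoint μ K (sectorCenter (m + 1) (ω : ℕ)) with hpF
  set eK : (Fin 2 → ℝ) → ℝ := fun p => frameLevel μ K (WithLp.toLp 2 p) with heK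
  set g₀ : ℝ := fderiv ℝ eK pF (Pi.single 0 1) with hg₀
  set g₁ : ℝ := fderiv ℝ eK pF (Pi.single 1 1) with hg₁
  have hN0 : 0 < Real.sqrt (g₀ ^ 2 + g₁ ^ 2) := lt_of_lt_of_le hγ (gradient_floor_klFermiPoint B hA hlo' hhi' (sectorCenter (m + 1) (ω : ℕ)))
  obtain ⟨v, hv⟩ : ∃ v : Fin 2 → ℤ, v = ![round (Nr * (-g₁ / Real.sqrt (g₀ ^ 2 + g₁ ^ 2))), round (Nr * (g₀ / Real.sqrt (g₀ ^ 2 + g₁ ^ 2)))] :=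
    ⟨_, rfl⟩
  have hv0 : v 0 = round (Nr * (-g₁ / Real.sqrt (g₀ ^ 2 + g₁ ^ 2))) := (by rw [hv]; rfl); have hv1 : v 1 = round (Nr * (g₀ / Real.sqrt (g₀ ^ 2 + g₁ ^ 2))) := by rw [hv]; rfl
  obtain ⟨htan, hvj, hvne⟩ := tangentStep_bounds eK pF (norm_fderiv_frameBand_le hA μ pF) hN0 hNr1 v hv0 hv1 (2 * π / L)
  have hunit : (-g₁ / Real.sqrt (g₀ ^ 2 + g₁ ^ 2)) ^ 2 + (g₀ / Real.sqrt (g₀ ^ 2 + g₁ ^ 2)) ^ 2 = 1 := by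
    rw [neg_div]; exact (frame_orthonormal hN0).2.1
  have hvlen : Nr - 1 ≤ Real.sqrt ((v 0 : ℝ) ^ 2 + (v 1 : ℝ) ^ 2) := by
    have h := sub_one_le_sqrt_sum_sq_round hNr2 (u := ![-g₁ / Real.sqrt (g₀ ^ 2 + g₁ ^ 2), g₀ / Real.sqrt (g₀ ^ 2 + g₁ ^ 2)]) hunit
    rw [hv0, hv1]
    exact h
  have hT := slicePairWt_bgmFat_sectional_le B hA hADt he hz hz1 hgap h3 hlo hhi hβ hρA m hMm hd hd1 hd2 hd3 hA3 ha3 hB0 hB hB30 hB3 hΛs hΛΛ'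
    hK₁ hK₂ hK₃ hB₁ hB₂ hB₃ hNr2 hLz hR₀ rfl rfl rfl hG₁ hG₂ hG₃ hκ₃F hKp rfl rfl rfl rfl rfl rfl rfl rfl ω ω' v hvne hvj hvlen htan
    one_pos hs₁0 hs₂0 hs₃0 hs₃'0 hr₁ hr₂ hr₃ hr₃'
  intro z₁
  refine (hT z₁).trans ?_
  -- the rate bracket at `s₀ = 1` in closed form (`Mβ := Λₛ`)
  have h0 : 1 / (1 : ℝ) = 1 * Λs / Λs := by field_simp
  have h0' : (1 : ℝ) ≤ 1 / 1 := by norm_num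
  have h1 : 1 / s₁ = x₁ / Λs := by rw [hs₁, hx₁]; field_simp
  have hratio : (Nr + 1 / 2) / (Nr - 1) ≤ 5 / 2 := by
    rw [div_le_iff₀ (by linarith only [hNr2])]; linarith only [hNr2]
  have hratio0 : 0 ≤ (Nr + 1 / 2) / (Nr - 1) := div_nonneg (by positivity) (by linarith only [hNr2])
  have h2 : 1 / (s₂ * (Nr - 1)) ≤ x₂ / Λs := by
    rw [hs₂, hx₂]
    have e : 1 / (2 * Λs / (π * (Nr + 1 / 2) * X₁) * (Nr - 1)) = (π / 2 * X₁) * ((Nr + 1 / 2) / (Nr - 1)) / Λs := by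
      field_simp
    rw [e]
    refine div_le_div_of_nonneg_right ?_ hΛs.le
    calc π / 2 * X₁ * ((Nr + 1 / 2) / (Nr - 1)) ≤ π / 2 * X₁ * (5 / 2) := mul_le_mul_of_nonneg_left hratio (by positivity)
      _ = 5 * π / 4 * X₁ := by ring
  have h3 : 1 / (s₃ * (Nr - 1)) ≤ x₃ * Nr := by
    rw [hs₃, hx₃]
    have e : 1 / (2 / (π * (Nr + 1 / 2) * Nr * Real.sqrt qv) * (Nr - 1)) = (π / 2 * Real.sqrt qv) * ((Nr + 1 / 2) / (Nr - 1)) * Nr := by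
      field_simp
    rw [e]
    refine mul_le_mul_of_nonneg_right ?_ hNr0.le
    calc π / 2 * Real.sqrt qv * ((Nr + 1 / 2) / (Nr - 1)) ≤ π / 2 * Real.sqrt qv * (5 / 2) := mul_le_mul_of_nonneg_left hratio (by positivity)
      _ = 5 * π / 4 * Real.sqrt qv := by ring
  have hf₂ : 2 * Real.sqrt 2 * s₁ / (s₂ * (Nr - 1)) ≤ 5 * Real.sqrt 2 := by
    have e : 2 * Real.sqrt 2 * s₁ / (s₂ * (Nr - 1)) = 2 * Real.sqrt 2 * ((Nr + 1 / 2) / (Nr - 1)) := by rw [hs₁, hs₂]; field_simp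
    rw [e]
    nlinarith only [hratio, Real.sqrt_nonneg 2]
  have hf₃ : 2 * Real.sqrt 2 * s₁ / (s₃' * (Nr - 1)) ≤ 5 * Real.sqrt 2 * X₃ := by
    have e : 2 * Real.sqrt 2 * s₁ / (s₃' * (Nr - 1)) = 2 * Real.sqrt 2 * ((Nr + 1 / 2) / (Nr - 1)) * (X₃ / X₁) := by
      rw [hs₁, hs₃']; field_simp
    rw [e]
    have hXX : X₃ / X₁ ≤ X₃ := div_le_self hX₃0.le hX₁1
    have hXX0 : 0 ≤ X₃ / X₁ := by positivity
    calc 2 * Real.sqrt 2 * ((Nr + 1 / 2) / (Nr - 1)) * (X₃ / X₁) ≤ 2 * Real.sqrt 2 * (5 / 2) * X₃ := by gcongr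
      _ = 5 * Real.sqrt 2 * X₃ := by ring
  have hW := wBracketWt_le (e₀ := e₀) (Mβ := Λs) (L := (L : ℝ)) one_pos hs₁0 hs₂0 hs₃0 hs₃'0 hΛs hΛse he₁ hNr2 hΛs.le zero_le_one hx₂0 hx₃0
    hδL hL h0 h0' h1 h2 h3 hΛL hR₀' (by positivity) (by positivity) hf₂ hf₃
  have eCW : 64 * (1 + 5 * Real.sqrt 2 + 5 * Real.sqrt 2 * X₃) ^ 2 *
      (4096 * 1 * (4 * ((2 * Real.sqrt 2 * x₂ + 2) * (2 * Real.sqrt 2 * x₃ + 1)) + 160 * x₁ * (x₁ + 1) ^ 2 / δL) * Λs * Nr / Λs ^ 2) =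
      CW * Nr / Λs := by rw [hCW]; field_simp
  rw [eCW] at hW
  -- the spatial cell count (geometry at the sector scale `Λ = rΛₛ`)
  have hY₁ : 2 ≤ Real.sqrt 2 * L * ((klScale e₀ m + (4 + 4 * A) * ρf ^ 2) / (2 * B.rhomin - 4 * A)) / π := by
    have h1' : 2 ≤ Real.sqrt 2 * L * (klScale e₀ m / (2 * B.rhomin - 4 * A)) / π := by
      rw [hΛm, le_div_iff₀ hπ, mul_div_assoc', le_div_iff₀ hγ]; linarith only [hL1]
    refine h1'.trans ?_
    gcongr
    exact le_add_of_nonneg_right (by positivity)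
  have hY₂ : 2 ≤ Real.sqrt 2 * L * (2 * ρf) / π := by
    have hlow : π * Real.sqrt 2 * (π / Nr) ≤ ρf := by
      rw [hρf, hw]
      have hsm := B.smax_pos; have hdt := B.Dtmin_pos
      have h1' : 0 ≤ (klScale e₀ m + B.smax * B.Dtmin * (3 * (π / Nr) / 4)) / (B.Dtmin - 2 * A) := by positivity
      have h2' : π * Real.sqrt 2 * (π / Nr) ≤ π * Real.sqrt 2 * (1 + (4 + 2 * A) / (B.Dtmin - 2 * A)) * (π / Nr) := by
        have h1'' : (1 : ℝ) ≤ 1 + (4 + 2 * A) / (B.Dtmin - 2 * A) := by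
          have : 0 ≤ (4 + 2 * A) / (B.Dtmin - 2 * A) := by positivity
          linarith only [this]
        have h2'' := mul_le_mul_of_nonneg_left h1'' (by positivity : 0 ≤ π * Real.sqrt 2 * (π / Nr))
        linarith only [h2'']
      linarith only [h1', h2']
    have hs2 : Real.sqrt 2 * Real.sqrt 2 = 2 := Real.mul_self_sqrt (by norm_num)
    have hLNr : Nr ≤ 2 * L := by
      have h1'' : 1 ≤ 2 * π * (Nr + 1 / 2) := by nlinarith only [Real.pi_gt_three, hNr0]
      have h2'' : Nr ≤ 2 * π * Nr * (Nr + 1 / 2) := by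
        calc Nr = Nr * 1 := (mul_one _).symm
          _ ≤ Nr * (2 * π * (Nr + 1 / 2)) := mul_le_mul_of_nonneg_left h1'' hNr0.le
          _ = 2 * π * Nr * (Nr + 1 / 2) := by ring
      linarith only [h2'', hLN, hL]
    rw [le_div_iff₀ hπ]
    calc 2 * π ≤ Real.sqrt 2 * L * (2 * (π * Real.sqrt 2 * (π / Nr))) := by
          rw [show Real.sqrt 2 * L * (2 * (π * Real.sqrt 2 * (π / Nr))) = (Real.sqrt 2 * Real.sqrt 2) * 2 * π * π * L / Nr by field_simp, hs2]
          rw [le_div_iff₀ hNr0]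
          have h1'' : 2 * π * Nr ≤ 2 * π * (2 * L) := mul_le_mul_of_nonneg_left hLNr (by positivity)
          have h2'' : 2 * π * (2 * L) ≤ 2 * 2 * π * π * L := by
            have h := mul_le_mul_of_nonneg_left (show (1 : ℝ) ≤ π by linarith only [Real.pi_gt_three])
              (by positivity : (0 : ℝ) ≤ 2 * 2 * π * L)
            linarith only [h]
          linarith only [h1'', h2'']
      _ ≤ Real.sqrt 2 * L * (2 * ρf) := by gcongr
  have hNc := fatCellCount_le (Kp := 4 + 4 * A) hΛ hL hγ hNr0 hΛm (by rw [← hKp]; exact hsh) hρfb (by positivity) hY₁ hY₂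
  have hNc' : (Real.sqrt 2 * L * ((klScale e₀ m + (4 + 4 * A) * ρf ^ 2) / (2 * B.rhomin - 4 * A)) / π + 2) * (Real.sqrt 2 * L * (2 * ρf) / π + 2) ≤
      CN * ((L : ℝ) ^ 2 * Λs / Nr) := by
    refine hNc.trans (le_of_eq ?_)
    rw [hCN, hΛsr']; ring
  -- the time-section count
  have hNt : klScale e₀ m * β / π + 3 ≤ 16 * Λs * β / π * r := by
    rw [hΛm, hΛsr'] at hπβ ⊢
    have h1' : 1 ≤ 4 * (r * Λs) * β / π := by rw [le_div_iff₀ hπ]; linarith only [hπβ]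
    have e : 16 * Λs * β / π * r = 4 * (4 * (r * Λs) * β / π) := by ring
    rw [e]; linarith only [h1']
  have hW0 : 0 ≤ 524288 * (1 / (1 : ℝ) + 1) *
      ((1 + 2 * Real.sqrt 2 * s₁ / (s₂ * (Nr - 1)) + 2 * Real.sqrt 2 * s₁ / (s₃' * (Nr - 1))) ^ 2 *
          ((2 * Real.sqrt 2 / (s₂ * (Nr - 1)) + 2) * (2 * Real.sqrt 2 / (s₃ * (Nr - 1)) + 2)) + (1 / s₁ + 1) ^ 2 / (1 + s₁ * R₀)) := by
    have : 0 < Nr - 1 := by linarith only [hNr2]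
    positivity
  have hNc0 : 0 ≤ (Real.sqrt 2 * L * ((klScale e₀ m + (4 + 4 * A) * ρf ^ 2) / (2 * B.rhomin - 4 * A)) / π + 2) * (Real.sqrt 2 * L * (2 * ρf) / π + 2) := by
    positivity
  exact alphaProductWtSectional_le_mul hW0 hNc0 hCW0 hCN0 hβ hL hΛs hNr0 hr0.le hW hNc' hNt

end Closed

end Summit.HubbardSuperconductivity.HubbardSuperconductivity.Theorems.TorusFourierL2

end
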